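import Literature.Analysis.UnboundedOperators.HeatExtensionDecay
import Literature.Analysis.UnboundedOperators.HeatKernelLpSmoothingProofs
import Literature.Analysis.UnboundedOperators.HeatKernelSmooth
import Mathlib.MeasureTheory.Function.ContinuousMapDense
import HarnessLib

/-!
# Uniform-in-time smallness of the `L^q` tails of the caloric extension of `Lᵖ` data

Analysis/UnboundedOperators support file (theorems only). For `g ∈ Lᵖ(E; F)` with `1 ≤ p < ∞`
(`E` a finite-dimensional real inner product space, `F` a real Banach space), an exponent
`q ∈ [p, ∞]` and a compact time range `[t₀, t₁] ⊂ (0, ∞)`, the `L^q` norm of the caloric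
extension `e^{tΔ}g = heatKernel t ⋆ g` (`HeatKernel.lean`) over the exterior region `{‖x‖ ≥ R}`
tends to `0` as `R → ∞`, **uniformly in `t ∈ [t₀, t₁]`**:

* `exists_forall_eLpNorm_heatExtension_restrict_compl_ball_le` —
  `∀ ε > 0, ∃ R₀, ∀ R ≥ R₀, ∀ t ∈ [t₀, t₁], ‖e^{tΔ}g‖_{L^q(‖x‖ ≥ R)} ≤ ε`.

This is the `Lᵖ`-data form of Bradshaw–Tsai, *Forward discretely self-similar solutions of the
Navier–Stokes equations II*, Ann. Henri Poincaré 18 (2017), Lemma 3.2 (printed for discretely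
self-similar weak-`L³` data, which split as `L¹ + L⁴`; the lemma is then applied to each piece).
Proof (density and the off-diagonal Gaussian bound, in place of the shell decomposition of
[BT1]): approximate `g` in `Lᵖ` by a continuous compactly supported `h` (Mathlib
`MemLp.exists_hasCompactSupport_eLpNorm_sub_le`); the error is controlled on the whole space by
the `Lᵖ → L^q` estimate `‖e^{tΔ}(g − h)‖_q ≤ C t^{-(n/2)(1/p−1/q)}‖g − h‖_p ≤
C t₀^{-(n/2)(1/p−1/q)}‖g − h‖_p` (`eLpNorm_heatExtension_le_rpow_holds`), and off the support
`e^{tΔ}h` is bounded by one fixed Gaussian for all `t ∈ [t₀, t₁]`,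
`‖e^{tΔ}h(x)‖ ≤ (4πt₀)^{-n/2} (∫‖h‖) e^{-‖x‖²/(16t₁)}` for `‖x‖ ≥ 2ρ`
(`norm_heatExtension_le_exp_mul`), whose `L^q` tails are `O(e^{-R²/(32t₁)})`
(`eLpNorm_gaussian_restrict_compl_ball_le`).

## Mathlib / tree search

Tree: `norm_heatExtension_le_exp_mul` (`HeatExtensionDecay.lean`),
`eLpNorm_heatExtension_le_rpow_holds` (`HeatKernelLpSmoothingProofs.lean`),
`memLp_gaussian_of_pos` (`HeatKernelGradient.lean`), `contDiff_heatExtension_holds`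
(`HeatKernelSmooth.lean`), `convolutionExistsAt_of_memLp`, `memLp_heatKernel` (`HeatKernel.lean`).
The tree had tail statements for the *space–time* mass `∫₀ᵀ∫_{‖x‖≥n} |e^{tΔ}g|^p → 0`
(`Literature.Analysis.FluidPDE.tendsto_lintegral_tail_enorm_heatExtension_rpow`) but no
slice-wise statement uniform in time (`lean search 'compl_ball.*heatExtension'`: none). Mathlib:
`MemLp.exists_hasCompactSupport_eLpNorm_sub_le`, `eLpNorm_le_mul_eLpNorm_of_ae_le_mul`,
`eLpNorm_mono_measure`, `eLpNorm_add_le`, `Real.rpow_le_rpow_of_nonpos`.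

## References

* Z. Bradshaw, T.-P. Tsai, *Forward discretely self-similar solutions of the Navier–Stokes
  equations II*, Ann. Henri Poincaré 18 (2017) 1095–1119 = arXiv:1510.07504, Lemma 3.2
  [BradshawTsai2017AHP].
* Y. Giga, M.-H. Giga, J. Saal, *Nonlinear PDEs*, Birkhäuser 2010, §1.1.3 [GigaGigaSaal2010].
-/

noncomputable section

open MeasureTheory Set Function Filter Metric
open scoped NNReal ENNReal Topology

namespace Literature.Analysis.UnboundedOperators

variable {E : Type*} [NormedAddCommGroup E] [InnerProductSpace ℝ E] [FiniteDimensional ℝ E]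
  [MeasurableSpace E] [BorelSpace E]
variable {F : Type*} [NormedAddCommGroup F] [NormedSpace ℝ F]

/-! ### Gaussian tails -/

omit [InnerProductSpace ℝ E] [FiniteDimensional ℝ E] in
/-- **Tails of a Gaussian in `L^q`**: for `0 < b`, `0 ≤ R` and every `q ∈ [0, ∞]`,
`‖e^{-b‖x‖²}‖_{L^q(‖x‖ ≥ R)} ≤ e^{-bR²/2} ‖e^{-b‖x‖²/2}‖_{L^q(E)}` (on `‖x‖ ≥ R`,
`e^{-b‖x‖²} ≤ e^{-bR²/2} e^{-b‖x‖²/2}`). [folklore] -/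
theorem eLpNorm_gaussian_restrict_compl_ball_le (μ : Measure E) {b : ℝ}
    (hb : 0 < b) {R : ℝ} (hR : 0 ≤ R) (q : ℝ≥0∞) :
    eLpNorm (fun x : E => Real.exp (-b * ‖x‖ ^ 2)) q (μ.restrict (ball (0 : E) R)ᶜ) ≤
      ENNReal.ofReal (Real.exp (-(b / 2) * R ^ 2)) *
        eLpNorm (fun x : E => Real.exp (-(b / 2) * ‖x‖ ^ 2)) q μ := by
  have hS : MeasurableSet (ball (0 : E) R)ᶜ := isOpen_ball.measurableSet.compl
  have hae : ∀ᵐ x ∂μ.restrict (ball (0 : E) R)ᶜ, ‖Real.exp (-b * ‖x‖ ^ 2)‖ ≤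
      Real.exp (-(b / 2) * R ^ 2) * ‖Real.exp (-(b / 2) * ‖x‖ ^ 2)‖ := by
    filter_upwards [ae_restrict_mem hS] with x hx
    rw [mem_compl_iff, mem_ball_zero_iff, not_lt] at hx
    rw [Real.norm_of_nonneg (Real.exp_pos _).le, Real.norm_of_nonneg (Real.exp_pos _).le,
      ← Real.exp_add]
    refine Real.exp_le_exp.2 ?_
    have hx2 : R ^ 2 ≤ ‖x‖ ^ 2 := pow_le_pow_left₀ hR hx 2
    nlinarith
  calc eLpNorm (fun x : E => Real.exp (-b * ‖x‖ ^ 2)) q (μ.restrict (ball (0 : E) R)ᶜ)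
      ≤ ENNReal.ofReal (Real.exp (-(b / 2) * R ^ 2)) *
          eLpNorm (fun x : E => Real.exp (-(b / 2) * ‖x‖ ^ 2)) q
            (μ.restrict (ball (0 : E) R)ᶜ) :=
        eLpNorm_le_mul_eLpNorm_of_ae_le_mul hae q
    _ ≤ _ := by
        gcongr
        exact Measure.restrict_le_self

omit [InnerProductSpace ℝ E] [FiniteDimensional ℝ E] [MeasurableSpace E] [BorelSpace E] in
/-- `e^{-bR²/2} → 0` as `R → ∞` (`0 < b`). [folklore] -/
theorem tendsto_exp_neg_mul_sq_atTop {b : ℝ} (hb : 0 < b) :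
    Tendsto (fun R : ℝ => Real.exp (-(b / 2) * R ^ 2)) atTop (𝓝 0) := by
  refine Real.tendsto_exp_atBot.comp ?_
  have h2 : Tendsto (fun R : ℝ => b / 2 * R ^ 2) atTop atTop :=
    (tendsto_pow_atTop two_ne_zero).const_mul_atTop (half_pos hb)
  refine (tendsto_neg_atTop_atBot.comp h2).congr fun R => ?_
  simp only [Function.comp_apply, neg_mul]

/-- The Gaussian tails `‖e^{-b‖x‖²}‖_{L^q(‖x‖ ≥ R)}` tend to `0` as `R → ∞` (`0 < b`, any
`q ∈ [0, ∞]`): the majorant `e^{-bR²/2}‖e^{-b‖x‖²/2}‖_q` of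
`eLpNorm_gaussian_restrict_compl_ball_le` tends to `0`, the Gaussian being in every `L^q`
(`memLp_gaussian_of_pos`). [folklore] -/
theorem tendsto_eLpNorm_gaussian_restrict_compl_ball {b : ℝ} (hb : 0 < b) (q : ℝ≥0∞) :
    Tendsto (fun R : ℝ => eLpNorm (fun x : E => Real.exp (-b * ‖x‖ ^ 2)) q
      (volume.restrict (ball (0 : E) R)ᶜ)) atTop (𝓝 0) := by
  set K : ℝ≥0∞ := eLpNorm (fun x : E => Real.exp (-(b / 2) * ‖x‖ ^ 2)) q volume with hK
  have hKtop : K ≠ ⊤ := (memLp_gaussian_of_pos (E := E) (half_pos hb) q).eLpNorm_ne_top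
  have h3 : Tendsto (fun R : ℝ => ENNReal.ofReal (Real.exp (-(b / 2) * R ^ 2)) * K) atTop
      (𝓝 0) := by
    have h4 := ENNReal.tendsto_ofReal (tendsto_exp_neg_mul_sq_atTop hb)
    rw [ENNReal.ofReal_zero] at h4
    have h5 := ENNReal.Tendsto.mul_const h4 (Or.inr hKtop)
    rwa [zero_mul] at h5
  refine tendsto_of_tendsto_of_tendsto_of_le_of_le' tendsto_const_nhds h3
    (Eventually.of_forall fun R => bot_le) ?_
  filter_upwards [eventually_ge_atTop (0 : ℝ)] with R hR
  exact eLpNorm_gaussian_restrict_compl_ball_le volume hb hR q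

/-! ### Compactly supported continuous data: one Gaussian majorant for all `t ∈ [t₀, t₁]` -/

/-- **Uniform Gaussian majorant off the support.** If `h` is integrable and vanishes off the
closed ball of radius `ρ`, then for `0 < t₀ ≤ t ≤ t₁` and `‖x‖ ≥ 2ρ`,
`‖e^{tΔ}h(x)‖ ≤ (4πt₀)^{-n/2} (∫‖h‖) e^{-‖x‖²/(16t₁)}` (`norm_heatExtension_le_exp_mul` with the
two factors made monotone in `t`). [folklore] -/
theorem norm_heatExtension_le_gaussian_of_mem_Icc {h : E → F} {ρ : ℝ}
    (hsupp : ∀ z, h z ≠ 0 → ‖z‖ ≤ ρ) (hhi : Integrable h) {t₀ t₁ : ℝ} (ht₀ : 0 < t₀)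
    {t : ℝ} (ht : t ∈ Icc t₀ t₁) {x : E} (hx : 2 * ρ ≤ ‖x‖) :
    ‖heatExtension h t x‖ ≤
      ((4 * Real.pi * t₀) ^ (-(Module.finrank ℝ E : ℝ) / 2) * ∫ z, ‖h z‖) *
        Real.exp (-(16 * t₁)⁻¹ * ‖x‖ ^ 2) := by
  have htpos : 0 < t := ht₀.trans_le ht.1
  have ht₁ : 0 < t₁ := htpos.trans_le ht.2
  have hI : 0 ≤ ∫ z, ‖h z‖ := integral_nonneg fun z => norm_nonneg _
  have h1 := norm_heatExtension_le_exp_mul hsupp hhi htpos hx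
  have h2 : (4 * Real.pi * t) ^ (-(Module.finrank ℝ E : ℝ) / 2) ≤
      (4 * Real.pi * t₀) ^ (-(Module.finrank ℝ E : ℝ) / 2) := by
    refine Real.rpow_le_rpow_of_nonpos (by positivity) ?_ ?_
    · exact mul_le_mul_of_nonneg_left ht.1 (by positivity)
    · have : (0 : ℝ) ≤ (Module.finrank ℝ E : ℝ) := Nat.cast_nonneg _
      exact div_nonpos_of_nonpos_of_nonneg (neg_nonpos.2 this) zero_le_two
  have h3 : Real.exp (-‖x‖ ^ 2 / (16 * t)) ≤ Real.exp (-(16 * t₁)⁻¹ * ‖x‖ ^ 2) := by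
    refine Real.exp_le_exp.2 ?_
    rw [neg_div, neg_mul, neg_le_neg_iff, inv_mul_eq_div]
    exact div_le_div_of_nonneg_left (sq_nonneg _) (by positivity)
      (mul_le_mul_of_nonneg_left ht.2 (by norm_num))
  calc ‖heatExtension h t x‖
      ≤ (4 * Real.pi * t) ^ (-(Module.finrank ℝ E : ℝ) / 2) *
          Real.exp (-‖x‖ ^ 2 / (16 * t)) * ∫ z, ‖h z‖ := h1
    _ ≤ (4 * Real.pi * t₀) ^ (-(Module.finrank ℝ E : ℝ) / 2) *
          Real.exp (-(16 * t₁)⁻¹ * ‖x‖ ^ 2) * ∫ z, ‖h z‖ := by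
        gcongr
    _ = _ := by ring

/-- **Uniform-in-time tails for compactly supported continuous data.** If `h : E → F` is
continuous with compact support, `0 < t₀ ≤ t₁`, then for every `ε > 0` there is `R₀` such that
`‖e^{tΔ}h‖_{L^q(‖x‖ ≥ R)} ≤ ε` for all `R ≥ R₀`, all `t ∈ [t₀, t₁]` and every exponent
`q ∈ [0, ∞]` fixed in advance (the Gaussian majorant of
`norm_heatExtension_le_gaussian_of_mem_Icc` has vanishing `L^q` tails). [folklore] -/
theorem exists_forall_eLpNorm_heatExtension_restrict_compl_ball_le_of_hasCompactSupport
    {h : E → F} (hh : Continuous h) (hhc : HasCompactSupport h) {t₀ t₁ : ℝ} (ht₀ : 0 < t₀)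
    (h01 : t₀ ≤ t₁) (q : ℝ≥0∞) {ε : ℝ≥0∞} (hε : 0 < ε) :
    ∃ R₀ : ℝ, ∀ R, R₀ ≤ R → ∀ t ∈ Icc t₀ t₁,
      eLpNorm (heatExtension h t) q (volume.restrict (ball (0 : E) R)ᶜ) ≤ ε := by
  have ht₁ : 0 < t₁ := ht₀.trans_le h01
  -- the support radius
  obtain ⟨ρ, hρ⟩ : ∃ ρ : ℝ, tsupport h ⊆ closedBall (0 : E) ρ :=
    hhc.isCompact.isBounded.subset_closedBall 0
  have hsupp : ∀ z, h z ≠ 0 → ‖z‖ ≤ ρ := fun z hz =>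
    mem_closedBall_zero_iff.1 (hρ (subset_tsupport h (mem_support.2 hz)))
  have hhi : Integrable h := hh.integrable_of_hasCompactSupport hhc
  set M : ℝ := (4 * Real.pi * t₀) ^ (-(Module.finrank ℝ E : ℝ) / 2) * ∫ z, ‖h z‖ with hM
  set b : ℝ := (16 * t₁)⁻¹ with hb
  have hbpos : 0 < b := by positivity
  -- the Gaussian tails are eventually `≤ ε / M`
  have htail := tendsto_eLpNorm_gaussian_restrict_compl_ball (E := E) hbpos q
  have hev : ∀ᶠ R in atTop, ENNReal.ofReal M *
      eLpNorm (fun x : E => Real.exp (-b * ‖x‖ ^ 2)) q (volume.restrict (ball (0 : E) R)ᶜ)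
        ≤ ε := by
    have h1 : Tendsto (fun R => ENNReal.ofReal M *
        eLpNorm (fun x : E => Real.exp (-b * ‖x‖ ^ 2)) q (volume.restrict (ball (0 : E) R)ᶜ))
        atTop (𝓝 0) := by
      have := ENNReal.Tendsto.const_mul (a := ENNReal.ofReal M) htail
        (Or.inr ENNReal.ofReal_ne_top)
      rwa [mul_zero] at this
    exact (h1.eventually (ge_mem_nhds hε))
  obtain ⟨R₁, hR₁⟩ := eventually_atTop.1 hev
  refine ⟨max R₁ (2 * ρ), fun R hR t ht => ?_⟩
  have hR1 : R₁ ≤ R := (le_max_left _ _).trans hR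
  have hR2 : 2 * ρ ≤ R := (le_max_right _ _).trans hR
  have hS : MeasurableSet (ball (0 : E) R)ᶜ := isOpen_ball.measurableSet.compl
  have hae : ∀ᵐ x ∂volume.restrict (ball (0 : E) R)ᶜ,
      ‖heatExtension h t x‖ ≤ M * ‖Real.exp (-b * ‖x‖ ^ 2)‖ := by
    filter_upwards [ae_restrict_mem hS] with x hx
    rw [mem_compl_iff, mem_ball_zero_iff, not_lt] at hx
    rw [Real.norm_of_nonneg (Real.exp_pos _).le]
    exact norm_heatExtension_le_gaussian_of_mem_Icc hsupp hhi ht₀ ht (hR2.trans hx)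
  calc eLpNorm (heatExtension h t) q (volume.restrict (ball (0 : E) R)ᶜ)
      ≤ ENNReal.ofReal M *
          eLpNorm (fun x : E => Real.exp (-b * ‖x‖ ^ 2)) q (volume.restrict (ball (0 : E) R)ᶜ) :=
        eLpNorm_le_mul_eLpNorm_of_ae_le_mul hae q
    _ ≤ ε := hR₁ R hR1

/-! ### `Lᵖ` data -/

/-- Additivity of the caloric extension on `Lᵖ` data at a point: `e^{tΔ}(f + g) = e^{tΔ}f + e^{tΔ}g`
pointwise for `f, g ∈ Lᵖ`, `1 ≤ p`, `t > 0` (both convolution integrals converge absolutely,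
Hölder against `G_t ∈ L^{p'}`). [folklore] -/
theorem heatExtension_add_apply_of_memLp' [CompleteSpace F] {f g : E → F} {p : ℝ≥0∞}
    (hf : MemLp f p volume) (hg : MemLp g p volume) (hp : 1 ≤ p) {t : ℝ} (ht : 0 < t) (x : E) :
    heatExtension (f + g) t x = heatExtension f t x + heatExtension g t x := by
  haveI : p.HolderConjugate (ENNReal.conjExponent p) := .conjExponent hp
  have hq : 1 ≤ ENNReal.conjExponent p := ENNReal.HolderConjugate.one_le (ENNReal.conjExponent p) p
  have hK := memLp_heatKernel (E := E) ht hq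
  exact ConvolutionExistsAt.distrib_add
    (convolutionExistsAt_of_memLp (ContinuousLinearMap.lsmul ℝ ℝ) hK hf x)
    (convolutionExistsAt_of_memLp (ContinuousLinearMap.lsmul ℝ ℝ) hK hg x)

omit [FiniteDimensional ℝ E] [MeasurableSpace E] [BorelSpace E] in
/-- The exponent `(n/2)(1/p − 1/q)` of the `Lᵖ → L^q` estimate is nonnegative for `p ≤ q`.
[folklore] -/
theorem smoothing_exponent_nonneg {p q : ℝ≥0∞} (hp : p ≠ 0) (hpq : p ≤ q) :
    0 ≤ (Module.finrank ℝ E : ℝ) / 2 * ((1 / p).toReal - (1 / q).toReal) := by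
  refine mul_nonneg (by positivity)
    (sub_nonneg.2 (ENNReal.toReal_mono ?_ (ENNReal.div_le_div_left hpq 1)))
  rw [one_div]
  exact ENNReal.inv_ne_top.2 hp

/-- **Uniform-in-time smallness of the `L^q` tails of the caloric extension of `Lᵖ` data**
([BT1] Lemma 3.2, `Lᵖ`-data form). Let `g ∈ Lᵖ(E; F)`, `1 ≤ p < ∞`, `p ≤ q ≤ ∞`, and
`0 < t₀ ≤ t₁`. Then for every `ε > 0` there is `R₀` such that
`‖e^{tΔ}g‖_{L^q(‖x‖ ≥ R)} ≤ ε` for all `R ≥ R₀` and all `t ∈ [t₀, t₁]`. Proof: density of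
`C_c(E; F)` in `Lᵖ`, the `Lᵖ → L^q` bound for the error (uniform for `t ≥ t₀`), and the
Gaussian majorant for the compactly supported part (uniform for `t ≤ t₁`). [cite: BradshawTsai2017AHP, Lemma 3.2] -/
theorem exists_forall_eLpNorm_heatExtension_restrict_compl_ball_le [CompleteSpace F]
    {g : E → F} {p q : ℝ≥0∞} (hp : 1 ≤ p) (hp' : p ≠ ∞) (hpq : p ≤ q)
    (hg : MemLp g p volume) {t₀ t₁ : ℝ} (ht₀ : 0 < t₀) (h01 : t₀ ≤ t₁) {ε : ℝ≥0∞}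
    (hε : 0 < ε) :
    ∃ R₀ : ℝ, ∀ R, R₀ ≤ R → ∀ t ∈ Icc t₀ t₁,
      eLpNorm (heatExtension g t) q (volume.restrict (ball (0 : E) R)ᶜ) ≤ ε := by
  have hp0 : p ≠ 0 := (zero_lt_one.trans_le hp).ne'
  have hq1 : 1 ≤ q := hp.trans hpq
  -- the `Lᵖ → L^q` constant, made uniform on `[t₀, ∞)`
  obtain ⟨C, hC⟩ := eLpNorm_heatExtension_le_rpow_holds (E := E) (F := F) hp hpq
  set a : ℝ := (Module.finrank ℝ E : ℝ) / 2 * ((1 / p).toReal - (1 / q).toReal) with ha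
  have ha0 : 0 ≤ a := smoothing_exponent_nonneg (E := E) hp0 hpq
  set A : ℝ≥0∞ := (C : ℝ≥0∞) * ENNReal.ofReal (t₀ ^ (-a)) with hA
  have hAtop : A + 1 ≠ ⊤ := ENNReal.add_ne_top.2 ⟨ENNReal.mul_ne_top ENNReal.coe_ne_top
    ENNReal.ofReal_ne_top, ENNReal.one_ne_top⟩
  have hA0 : A + 1 ≠ 0 := by simp
  have hfactor : ∀ t ∈ Icc t₀ t₁, (C : ℝ≥0∞) * ENNReal.ofReal
      (t ^ (-((Module.finrank ℝ E : ℝ) / 2) * ((1 / p).toReal - (1 / q).toReal))) ≤ A := by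
    intro t ht
    rw [hA]
    gcongr
    rw [show -((Module.finrank ℝ E : ℝ) / 2) * ((1 / p).toReal - (1 / q).toReal) = -a by
      rw [ha]; ring]
    exact Real.rpow_le_rpow_of_nonpos ht₀ ht.1 (neg_nonpos.2 ha0)
  -- approximate `g` by a continuous compactly supported `h`
  set δ : ℝ≥0∞ := (ε / 2) / (A + 1) with hδ
  have hδ0 : δ ≠ 0 := (ENNReal.div_pos_iff.2 ⟨(ENNReal.half_pos hε.ne').ne', hAtop⟩).ne'
  obtain ⟨h, hhc, hgh, hhcont, hhp⟩ := hg.exists_hasCompactSupport_eLpNorm_sub_le hp' hδ0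
  have hgh' : MemLp (g - h) p volume := hg.sub hhp
  -- tails of the compactly supported part
  obtain ⟨R₀, hR₀⟩ :=
    exists_forall_eLpNorm_heatExtension_restrict_compl_ball_le_of_hasCompactSupport hhcont hhc
      ht₀ h01 q (ENNReal.half_pos hε.ne')
  refine ⟨R₀, fun R hR t ht => ?_⟩
  have htpos : 0 < t := ht₀.trans_le ht.1
  -- `e^{tΔ}g = e^{tΔ}(g - h) + e^{tΔ}h`
  have hsplit : heatExtension g t = heatExtension (g - h) t + heatExtension h t := by
    funext x
    have := heatExtension_add_apply_of_memLp' hgh' hhp hp htpos x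
    rwa [sub_add_cancel] at this
  have hm1 : AEStronglyMeasurable (heatExtension (g - h) t)
      (volume.restrict (ball (0 : E) R)ᶜ) :=
    (contDiff_heatExtension_holds hgh' hp htpos).continuous.aestronglyMeasurable
  have hm2 : AEStronglyMeasurable (heatExtension h t) (volume.restrict (ball (0 : E) R)ᶜ) :=
    (contDiff_heatExtension_holds hhp hp htpos).continuous.aestronglyMeasurable
  -- the error term on the whole space
  have herr : eLpNorm (heatExtension (g - h) t) q (volume.restrict (ball (0 : E) R)ᶜ) ≤ ε / 2 :=
    calc eLpNorm (heatExtension (g - h) t) q (volume.restrict (ball (0 : E) R)ᶜ)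
        ≤ eLpNorm (heatExtension (g - h) t) q volume :=
          eLpNorm_mono_measure _ Measure.restrict_le_self
      _ ≤ (C : ℝ≥0∞) * ENNReal.ofReal
          (t ^ (-((Module.finrank ℝ E : ℝ) / 2) * ((1 / p).toReal - (1 / q).toReal))) *
            eLpNorm (g - h) p volume := hC (g - h) hgh' t htpos
      _ ≤ A * δ := mul_le_mul' (hfactor t ht) hgh
      _ ≤ (A + 1) * δ := by gcongr; exact le_self_add
      _ = ε / 2 := ENNReal.mul_div_cancel hA0 hAtop
  calc eLpNorm (heatExtension g t) q (volume.restrict (ball (0 : E) R)ᶜ)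
      = eLpNorm (heatExtension (g - h) t + heatExtension h t) q
          (volume.restrict (ball (0 : E) R)ᶜ) := by rw [hsplit]
    _ ≤ eLpNorm (heatExtension (g - h) t) q (volume.restrict (ball (0 : E) R)ᶜ) +
          eLpNorm (heatExtension h t) q (volume.restrict (ball (0 : E) R)ᶜ) :=
        eLpNorm_add_le hm1 hm2 hq1
    _ ≤ ε / 2 + ε / 2 := add_le_add herr (hR₀ R hR t ht)
    _ = ε := ENNReal.add_halves ε

end Literature.Analysis.UnboundedOperators

end
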